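import Literature.AlgebraicGeometry.HilbertScheme.TranslationActionCohomology
import Literature.AlgebraicGeometry.HodgeTheory.FiniteDeckCoverGysin
import Literature.AlgebraicGeometry.Hyperkaehler.TotalCohomologyCross
import Literature.AlgebraicGeometry.Motives.JacobianDimensionProofs
import HarnessLib

/-!
# `θ_*` lands in `H*(A^[n]) · [Kⁿ(A)]` and `ker θ* = Ann([Kⁿ(A)])` — Kapfer–Menet Lemma 5.4 and
Proposition 5.5, PROVED modulo Beauville's Galois cover

Layer `Literature/AlgebraicGeometry/Hyperkaehler`; THEOREMS ONLY — no definition, no named fact, sorry-free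
(D-0026).  Rider on `GeneralizedKummerHilbertSchemePullback` (the named facts `KapferMenet2018_lemma_5_4`,
`KapferMenet2018_ker_pullback_eq_annihilator`, the class `[K] = θ_*(1)` `kummerFibreClass`, `totalGysin`,
`cupAnnihilator`), on `HilbertScheme/HilbertSchemeTranslationAction` (Beauville's cover
`Θ = kummerCover act j : A × K → A^[n+1]`, `(a, ξ) ↦ t_a(j ξ)`, and the named fact
`Beauville1983_kummerCover_galois`: `Θ(ℂ)` is a finite regular cover with deck transformations
`(t_b × τ_b)(ℂ)`), on `HilbertScheme/TranslationActionCohomology` (`(1, 𝟙_K) ≫ Θ = j`, slices are homotopic) and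
on `HodgeTheory/FiniteDeckCoverGysin` (`Θ^* Θ_* = μ⁻¹ Σ_g g^*` for a finite regular cover).

S. Kapfer, G. Menet, *Integral cohomology of the generalized Kummer fourfold*, Algebraic Geometry 5 (2018), §5,
arXiv:1607.03431 p. 13, `θ : K_{n−1}(A) ↪ A^[n]`, `[K] = θ_*(1)`:

* **Lemma 5.4** "Let `β ∈ H*(K_{n−1}(A), ℚ)`. Then there is a class `B ∈ H*(A^[n], ℚ)` such that
  `θ_*(β) = n⁻⁴ B · [K_{n−1}(A)]`."  Printed proof: "`Θ : K_{n−1}(A) × A → A^[n]`, `Θ(ξ, a) = t_a(θ(ξ))` … realizes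
  `K_{n−1}(A) × A` as a `n⁴`-fold covering of `A^[n]` … set `B := Θ_*(β ⊗ 1)`. Then the projection formula gives
  `B · [K] = Θ_*(β ⊗ 1 · Θ^*[K]) = n⁴ Θ_*((β ⊗ 1) · (1 ⊗ x)) = n⁴ Θ_*(β ⊗ x) = n⁴ θ_*(β)`."
* **Proposition 5.5** "The kernel of `θ*` is equal to the annihilator of `[K_{n−1}(A)]`."  Printed proof:
  `⊆` by `[K]·α = θ_*θ*(α)`; `⊇` by Poincaré duality on `K` and Lemma 5.4.

## What is proved, and how the printed proof is followed

We follow the printed architecture with `B := Θ_*(pr_K^* β)` (`= Θ_*(β ⊗ 1)`) and the projection formula for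
`Θ`; the one geometric input of the printed proof that the tree cannot state as printed — the transversality
identity `Θ^*[K] = n⁴ · (1 ⊗ x)` for the fibre square of the `n⁴`-fold cover — is replaced by its transfer form:
`Θ^*[K] = Θ^*Θ_*(ι_*1) = μ⁻¹ Σ_g g^*(ι_*1) = (|G|/μ) · ι_*1` (`ι = (1, 𝟙_K) : K → A × K` the slice, `θ = Θ ∘ ι`;
`Θ^*Θ_* = μ⁻¹ Σ_g g^*` is `HodgeTheory.map_complexGysin_eq_smul_sum`), where **`g^*(ι_*1) = ι_*1` for every deck
transformation `g = (t_b × τ)(ℂ)`** (`map_deck_complexGysin_slice_one`: by Poincaré duality on `A × K`, deck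
transformations acting trivially on top cohomology, `g ∘ ι = ι_b ∘ τ` with `ι_b` the slice at `b` — homotopic
to `ι` in the path-connected `A(ℂ)` — and `τ(ℂ)` a homeomorphism of `K(ℂ)` preserving `∫_K`, Fulton's degree
formula with a one-point fibre).  `ι_*β = pr_K^*β ∪ ι_*1` and `β ⊗ x ↦ θ_*β` are the projection formula for `ι`.
The printed constant `n⁻⁴` is immaterial over `ℂ` (`B` is only asserted to exist); we obtain
`θ_*β = (μ/|G|) · B ∪ [K]` and rescale.

* `exists_complexGysin_kummerFibre_eq_cup` — Lemma 5.4 degreewise, from the cover data;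
* `kapferMenet2018_lemma_5_4_of_galois : Beauville1983_kummerCover_galois → KapferMenet2018_lemma_5_4`;
* `ker_totalPullback_le_cupAnnihilator` — Prop. 5.5 `⊆`, unconditionally (projection formula);
* `kapferMenet2018_ker_pullback_eq_annihilator_of_lemma_5_4 :
    KapferMenet2018_lemma_5_4 → KapferMenet2018_ker_pullback_eq_annihilator` (Poincaré duality on `K`);
* `kapferMenet2018_ker_pullback_eq_annihilator_of_galois : Beauville1983_kummerCover_galois → …`;
* `cupIdeal_degreeOne_le_cupAnnihilator_of_h1` — the inclusion `⟨H¹⟩ ⊆ Ann([K])` of Prop. 5.7, from `b₁(K) = 0`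
  (the reverse inclusion, the content of Prop. 5.7, is NOT proved here).

So both Kapfer–Menet facts are theorems CONDITIONAL on the single refereed fact `Beauville1983_kummerCover_galois`
(Beauville 1983 §7 footnote 2); nothing here discharges that fact, and nothing here asserts V0 / L1 / any case of
the Hodge conjecture.  Count-neutral (0 new facts).

## References

* [KapferMenet2018] S. Kapfer, G. Menet, Integral cohomology of the generalized Kummer fourfold, Algebraic Geometry 5
  (2018) 523–567, Lemma 5.4 and Prop. 5.5 with proofs (arXiv:1607.03431 p. 13).
* [Beauville1983] A. Beauville, Variétés kählériennes dont la première classe de Chern est nulle, J. Differential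
  Geom. 18 (1983), §7 p. 769 footnote 2 (the cartesian square `A × K_r → A^[r+1]` over `(r+1) : A → A`).
* [FultonYoungTableaux1997] W. Fulton, Young Tableaux, CUP 1997, App. B §B.1 (5)–(6) (Gysin maps, projection
  formula).
* [HatcherAT2002] A. Hatcher, Algebraic Topology, CUP 2002, §3.G (transfer), §3.3 Prop. 3.38 (Poincaré duality
  over a field), §3.2 Thm. 3.11 (graded commutativity).
-/

noncomputable section

open CategoryTheory MonoidalCategory CartesianMonoidalCategory DirectSum
open Literature.AlgebraicTopology.SingularHomology
open Literature.AlgebraicGeometry.Motives (SchemeOver AbelianVariety ComplexPoints AlgPoints IsSmoothProjective)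
open Literature.AlgebraicGeometry.HilbertScheme
open Literature.AlgebraicGeometry.HodgeTheory

namespace Literature.AlgebraicGeometry.Hyperkaehler

open scoped MonObj

universe u v

/-! ### §0 Components of `f^*` and of `c ∪ ·` on the total cohomology `⨁ₖ Hᵏ` -/

section Components

variable {R : Type v} [CommRing R] {Z Z' : Type u} [TopologicalSpace Z] [TopologicalSpace Z']

/-- `(f^* v)ₖ = f^*(vₖ)`: the total pull-back acts degreewise. [cite: HatcherAT2002, §3.1 (induced homomorphisms)] -/
theorem totalPullback_apply_apply (f : C(Z, Z')) (v : totalCohomology R Z') (k : ℕ) :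
    totalPullback R f v k = singularCohomology.map R R f k (v k) := by
  induction v using DirectSum.induction_on with
  | zero => rw [map_zero, DirectSum.zero_apply, DirectSum.zero_apply, map_zero]
  | of i x =>
    rw [← DirectSum.lof_eq_of R, totalPullback_lof, DirectSum.lof_eq_of, DirectSum.lof_eq_of]
    by_cases hik : i = k
    · subst hik
      rw [DirectSum.of_eq_same, DirectSum.of_eq_same]
    · rw [DirectSum.of_eq_of_ne _ _ _ (Ne.symm hik), DirectSum.of_eq_of_ne _ _ _ (Ne.symm hik), map_zero]
  | add v w hv hw => rw [map_add, DirectSum.add_apply, DirectSum.add_apply, hv, hw, map_add]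

/-- **`f^* v = 0` iff `f^* vₖ = 0` in every degree.** [cite: HatcherAT2002, §3.1 (induced homomorphisms)] -/
theorem totalPullback_eq_zero_iff (f : C(Z, Z')) (v : totalCohomology R Z') :
    totalPullback R f v = 0 ↔ ∀ k : ℕ, singularCohomology.map R R f k (v k) = 0 := by
  constructor
  · intro h k
    rw [← totalPullback_apply_apply, h, DirectSum.zero_apply]
  · intro h
    refine DirectSum.ext _ fun k ↦ ?_
    rw [totalPullback_apply_apply, h k, DirectSum.zero_apply]

/-- `(x ∪ v)_{p+k} = x ∪ vₖ` for a homogeneous `x ∈ Hᵖ`. [cite: HatcherAT2002, §3.2 (the cohomology ring)] -/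
theorem totalCup_ofDegree_apply_add (p : ℕ) (x : singularCohomology R R Z p) (v : totalCohomology R Z)
    (k : ℕ) : totalCup R Z (ofDegree R Z p x) v (p + k) = cupProduct rfl x (v k) := by
  induction v using DirectSum.induction_on with
  | zero => rw [map_zero, DirectSum.zero_apply, DirectSum.zero_apply, map_zero]
  | of i y =>
    rw [← DirectSum.lof_eq_of R, totalCup_lof, DirectSum.lof_eq_of, DirectSum.lof_eq_of]
    by_cases hik : i = k
    · subst hik
      rw [DirectSum.of_eq_same, DirectSum.of_eq_same]
    · rw [DirectSum.of_eq_of_ne _ _ _ (by omega), DirectSum.of_eq_of_ne _ _ _ (Ne.symm hik), map_zero]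
  | add v w hv hw => rw [map_add, DirectSum.add_apply, DirectSum.add_apply, hv, hw, map_add]

/-- `(v ∪ x)_{k+p} = vₖ ∪ x` for a homogeneous `x ∈ Hᵖ`. [cite: HatcherAT2002, §3.2 (the cohomology ring)] -/
theorem totalCup_apply_ofDegree_add (v : totalCohomology R Z) (p : ℕ) (x : singularCohomology R R Z p)
    (k : ℕ) : totalCup R Z v (ofDegree R Z p x) (k + p) = cupProduct rfl (v k) x := by
  induction v using DirectSum.induction_on with
  | zero => rw [map_zero, LinearMap.zero_apply, DirectSum.zero_apply, DirectSum.zero_apply, LinearMap.map_zero₂]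
  | of i y =>
    rw [← DirectSum.lof_eq_of R, totalCup_lof, DirectSum.lof_eq_of, DirectSum.lof_eq_of]
    by_cases hik : i = k
    · subst hik
      rw [DirectSum.of_eq_same, DirectSum.of_eq_same]
    · rw [DirectSum.of_eq_of_ne _ _ _ (by omega), DirectSum.of_eq_of_ne _ _ _ (Ne.symm hik),
        LinearMap.map_zero₂]
  | add v w hv hw =>
    rw [map_add, LinearMap.add_apply, DirectSum.add_apply, DirectSum.add_apply, hv, hw, LinearMap.map_add₂]

/-- **`x ∪ v = 0` iff `x ∪ vₖ = 0` in every degree** (`x` homogeneous). [cite: HatcherAT2002, §3.2 (the cohomology ring)] -/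
theorem totalCup_ofDegree_eq_zero_iff (p : ℕ) (x : singularCohomology R R Z p) (v : totalCohomology R Z) :
    totalCup R Z (ofDegree R Z p x) v = 0 ↔ ∀ k : ℕ, cupProduct rfl x (v k) = 0 := by
  classical
  constructor
  · intro h k
    rw [← totalCup_ofDegree_apply_add, h, DirectSum.zero_apply]
  · intro h
    conv_lhs => rw [← DirectSum.sum_support_of v]
    rw [map_sum]
    refine Finset.sum_eq_zero fun i _ ↦ ?_
    rw [← DirectSum.lof_eq_of R, totalCup_lof, h i, map_zero]

end Components

/-! ### §1 The slices `ι_b = (b, 𝟙_K) : K → A × K` and the product `A × K` -/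

section Slices

variable {n : ℕ} {A : AbelianVariety ℂ} {K : SchemeOver ℂ}

/-- `A × K` is smooth projective of dimension `2(n+1)` for an abelian surface `A` and `K` smooth projective of
dimension `2n` (products of smooth projective varieties, `IsSmoothProjective.tensor_holds`).
[cite: Beauville1983, §7 p. 769 footnote 2] -/
theorem isSmoothProjective_abelianSurface_tensor (hA : A.dim = 2) (hKs : IsSmoothProjective (2 * n) K) :
    IsSmoothProjective (2 * (n + 1)) (A.X ⊗ K) := by
  have hA2 : IsSmoothProjective A.dim A.X := Motives.AbelianVariety.isSmoothProjective_holds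
  rw [hA] at hA2
  have h := Motives.IsSmoothProjective.tensor_holds hA2 hKs
  rwa [show 2 + 2 * n = 2 * (n + 1) by ring] at h

/-- The slice is a section of the projection: `(b, 𝟙_K) ≫ pr_K = 𝟙_K`. [cite: KapferMenet2018, Lemma 5.4 (proof) p. 13] -/
theorem slice_comp_snd (b : 𝟙_ (SchemeOver ℂ) ⟶ A.X) : lift (toUnit K ≫ b) (𝟙 K) ≫ snd A.X K = 𝟙 K :=
  lift_snd _ _

/-- **`(1, 𝟙_K) ≫ (t_b × τ) = τ ≫ (b, 𝟙_K)`**: a deck transformation `t_b × τ` carries the slice `{1} × K` to the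
slice `{b} × K`, through `τ` ("`Θ(ξ, a) = t_a(θ(ξ))`"). [cite: KapferMenet2018, Lemma 5.4 (proof) p. 13]
[cite: Beauville1983, §7 p. 769 footnote 2] -/
theorem sliceOne_comp_translate_tensorHom (b : 𝟙_ (SchemeOver ℂ) ⟶ A.X) (τ : K ⟶ K) :
    lift (toUnit K ≫ (1 : 𝟙_ (SchemeOver ℂ) ⟶ A.X)) (𝟙 K) ≫ (A.translate b ⊗ₘ τ) =
      τ ≫ lift (toUnit K ≫ b) (𝟙 K) := by
  refine CartesianMonoidalCategory.hom_ext _ _ ?_ ?_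
  · simp only [Category.assoc, tensorHom_fst, lift_fst, lift_fst_assoc, comp_toUnit_assoc]
    rw [Motives.AbelianVariety.translate, MonObj.comp_mul, MonObj.comp_mul, comp_toUnit_assoc, comp_toUnit_assoc,
      Category.comp_id, MonObj.comp_one, mul_one]
  · simp only [Category.assoc, tensorHom_snd, lift_snd, lift_snd_assoc, Category.id_comp, Category.comp_id]

/-- **All slices `ι_b = (b, 𝟙_K)` induce the same map `Hᵏ((A × K)(ℂ)) → Hᵏ(K(ℂ))`**: `ι_b` and `ι_{b'}` are
homotopic through slices along a path from `b` to `b'` in the path-connected group `A(ℂ)` (the tree's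
`complexBetti_map_translateHilb_eq` for the "action" `A ◁ pr_K : A × (A × K) → A × K`, whose translation maps satisfy
`(1, 𝟙_K) ≫ translateHilb (A ◁ pr_K) b = ι_b`).  (In the Lean text the slice is spelled out, or named `sl`:
the letter `ι` is notation of `MonObj`.)
[cite: Beauville1983, §7 p. 769 ("A étant connexe")] [cite: HatcherAT2002, §3.1 p. 201] -/
theorem complexBetti_map_slice_eq (b b' : 𝟙_ (SchemeOver ℂ) ⟶ A.X) (k : ℕ) :
    complexBetti.map (lift (toUnit K ≫ b) (𝟙 K)) k = complexBetti.map (lift (toUnit K ≫ b') (𝟙 K)) k := by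
  -- the homotopy lemma for the "action" `A ◁ pr_K : A × (A × K) → A × K`, `(x, (y, ξ)) ↦ (x, ξ)`, whose
  -- translation maps are `translateHilb (A ◁ pr_K) b = (x', ξ) ↦ (b, ξ)`; then `ι_b = (1, 𝟙_K) ≫ translateHilb (A ◁ pr_K) b`.
  have h := complexBetti_map_translateHilb_eq (A := A) (H := A.X ⊗ K) (A.X ◁ snd A.X K) b b' k
  have hfac : ∀ a : 𝟙_ (SchemeOver ℂ) ⟶ A.X, lift (toUnit K ≫ a) (𝟙 K) =
      lift (toUnit K ≫ (1 : 𝟙_ (SchemeOver ℂ) ⟶ A.X)) (𝟙 K) ≫ translateHilb (A.X ◁ snd A.X K) a := by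
    intro a
    refine CartesianMonoidalCategory.hom_ext _ _ ?_ ?_
    · simp only [translateHilb, Category.assoc, whiskerLeft_fst, lift_fst, comp_toUnit_assoc]
    · simp only [translateHilb, Category.assoc, whiskerLeft_snd, lift_snd, lift_snd_assoc, Category.id_comp]
  rw [hfac b, hfac b', complexBetti.map_comp, complexBetti.map_comp, h]

/-- `pr_K ∘ (f × τ) = τ ∘ pr_K` on complex points. [cite: KapferMenet2018, Lemma 5.4 (proof) p. 13] -/
theorem map_snd_map_tensorHom (f : A.X ⟶ A.X) (τ : K ⟶ K) (e : ComplexPoints (A.X ⊗ K)) :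
    AlgPoints.map (snd A.X K) (AlgPoints.map (f ⊗ₘ τ) e) = AlgPoints.map τ (AlgPoints.map (snd A.X K) e) := by
  rw [← AlgPoints.map_comp_apply, ← AlgPoints.map_comp_apply, tensorHom_snd]

end Slices

/-! ### §2 The deck transformations `(t_b × τ)(ℂ)` of a finite regular cover `(A × K)(ℂ) → H(ℂ)` -/

section Deck

variable {n : ℕ} {A : AbelianVariety ℂ} {K H : SchemeOver ℂ}
  {G : Type} [Group G] [Fintype G] [MulAction G (ComplexPoints (A.X ⊗ K))]

/-- **The `K`-components of inverse deck transformations are inverse on `K(ℂ)`**: if `g` acts by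
`(t_b × τ)(ℂ)` and `g⁻¹` by `(t_{b'} × τ')(ℂ)`, then `τ'(ℂ) ∘ τ(ℂ) = id` (apply `g⁻¹ g = 1` to a point of the slice
`{1} × K` and project to `K`). [cite: KapferMenet2018, Lemma 5.4 (proof) p. 13] [cite: Beauville1983, §7 p. 769 footnote 2] -/
theorem map_deckSnd_map_deckSnd (c : FiniteDeckCover G (ComplexPoints (A.X ⊗ K)) (ComplexPoints H)) {g : G}
    {b b' : 𝟙_ (SchemeOver ℂ) ⟶ A.X} {τ τ' : K ⟶ K}
    (hg : c.deck g = AlgPoints.mapContinuous (L := ℂ) (A.translate b ⊗ₘ τ))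
    (hg' : c.deck g⁻¹ = AlgPoints.mapContinuous (L := ℂ) (A.translate b' ⊗ₘ τ')) (ξ : ComplexPoints K) :
    AlgPoints.map τ' (AlgPoints.map τ ξ) = ξ := by
  set e : ComplexPoints (A.X ⊗ K) :=
    AlgPoints.map (lift (toUnit K ≫ (1 : 𝟙_ (SchemeOver ℂ) ⟶ A.X)) (𝟙 K)) ξ with he
  have hξ : AlgPoints.map (snd A.X K) e = ξ := by
    rw [he, ← AlgPoints.map_comp_apply, lift_snd, AlgPoints.map_id_apply]
  have h1 : AlgPoints.map (A.translate b' ⊗ₘ τ') (AlgPoints.map (A.translate b ⊗ₘ τ) e) = e := by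
    have h2 : g⁻¹ • g • e = e := inv_smul_smul g e
    rwa [← c.deck_apply g e, ← c.deck_apply g⁻¹, hg, hg', AlgPoints.mapContinuous_apply,
      AlgPoints.mapContinuous_apply] at h2
  have h3 := congrArg (AlgPoints.map (snd A.X K)) h1
  rwa [map_snd_map_tensorHom, map_snd_map_tensorHom, hξ] at h3

/-- **The `K`-component `τ` of a deck transformation `(t_b × τ)(ℂ)` preserves `∫_K`**: `τ(ℂ)` is a homeomorphism
of `K(ℂ)` (`map_deckSnd_map_deckSnd` both ways) under which a point has exactly one preimage, so
`τ(ℂ)_*[K(ℂ)] = [K(ℂ)]` for the complex orientation (Fulton's degree formula,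
`map_fundamentalClass_complexOrientationFamily_of_finite_fibre`) and `∫_K τ^* v = ∫_K v`.
[cite: Fulton1998, Lemma 19.1.2] [cite: Beauville1983, §7 p. 769 footnote 2] -/
theorem traceC_map_deckSnd (hKs : IsSmoothProjective (2 * n) K)
    (c : FiniteDeckCover G (ComplexPoints (A.X ⊗ K)) (ComplexPoints H)) {g : G}
    {b b' : 𝟙_ (SchemeOver ℂ) ⟶ A.X} {τ τ' : K ⟶ K}
    (hg : c.deck g = AlgPoints.mapContinuous (L := ℂ) (A.translate b ⊗ₘ τ))
    (hg' : c.deck g⁻¹ = AlgPoints.mapContinuous (L := ℂ) (A.translate b' ⊗ₘ τ'))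
    (v : complexBetti K (2 * (2 * n))) : traceC hKs (complexBetti.map τ (2 * (2 * n)) v) = traceC hKs v := by
  classical
  obtain ⟨ξ₀⟩ := Motives.nonempty_algPoints_of_isSmoothProjective hKs
  have hl : Function.LeftInverse (AlgPoints.map (L := ℂ) τ') (AlgPoints.map (L := ℂ) τ) :=
    map_deckSnd_map_deckSnd c hg hg'
  have hg'' : c.deck g⁻¹⁻¹ = AlgPoints.mapContinuous (L := ℂ) (A.translate b ⊗ₘ τ) := by
    rw [inv_inv]; exact hg
  have hr : Function.RightInverse (AlgPoints.map (L := ℂ) τ') (AlgPoints.map (L := ℂ) τ) :=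
    map_deckSnd_map_deckSnd c hg' hg''
  let eτ : ComplexPoints K ≃ₜ ComplexPoints K :=
    { toFun := AlgPoints.map τ
      invFun := AlgPoints.map τ'
      left_inv := hl
      right_inv := hr
      continuous_toFun := (AlgPoints.mapContinuous (L := ℂ) τ).continuous
      continuous_invFun := (AlgPoints.mapContinuous (L := ℂ) τ').continuous }
  have hv : Function.Injective fun _ : Unit ↦ ξ₀ := fun _ _ _ ↦ Subsingleton.elim _ _
  have hfibre : (AlgPoints.map τ) ⁻¹' {AlgPoints.map τ ξ₀} = Set.range fun _ : Unit ↦ ξ₀ := by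
    ext ξ
    simp only [Set.mem_preimage, Set.mem_singleton_iff, Set.mem_range, exists_const]
    constructor
    · intro h
      exact (hl.injective h).symm
    · rintro rfl
      rfl
  have hloc : ∀ i : Unit, ∃ e : OpenPartialHomeomorph (ComplexPoints K) (ComplexPoints K),
      (fun _ : Unit ↦ ξ₀) i ∈ e.source ∧ (e : ComplexPoints K → ComplexPoints K) = AlgPoints.map τ :=
    fun _ ↦ ⟨eτ.toOpenPartialHomeomorph,
      by rw [Homeomorph.toOpenPartialHomeomorph_source]; exact Set.mem_univ _,
      Homeomorph.toOpenPartialHomeomorph_apply eτ⟩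
  have hdeg := map_fundamentalClass_complexOrientationFamily_of_finite_fibre hKs hKs τ hv hfibre hloc
  rw [Fintype.card_unit, Nat.cast_one] at hdeg
  rw [traceC_map_of_map_fundamentalClass hKs hKs τ hdeg v, one_mul]

end Deck

/-! ### §3 Gysin morphisms of the slice `ι = (1, 𝟙_K)` and of the cover `Θ` -/

section Gysin

variable {n : ℕ} {A : AbelianVariety ℂ} {K H : SchemeOver ℂ}

/-- **`θ_* = Θ_* ∘ ι_*`** for `θ = j = ι ≫ Θ` (`ι = sl` any morphism `K ⟶ A × K`; functoriality of Gysin morphisms, `complexGysin_comp`).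
[cite: KapferMenet2018, Lemma 5.4 (proof) p. 13 ("Θ_*(β ⊗ x) = θ_*(β)")] [cite: FultonYoungTableaux1997, Appendix B §B.1 (2), (5)] -/
theorem complexGysin_kummerFibre_eq_comp (hKs : IsSmoothProjective (2 * n) K)
    (hE : IsSmoothProjective (2 * (n + 1)) (A.X ⊗ K)) (hH : IsSmoothProjective (2 * (n + 1)) H)
    {sl : K ⟶ A.X ⊗ K} {Θ : A.X ⊗ K ⟶ H} {j : K ⟶ H} (hιΘ : sl ≫ Θ = j) {a b : ℕ}
    (hab : a + 2 * (2 * (n + 1)) = b + 2 * (2 * n)) (β : complexBetti K a) :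
    complexGysin complexOrientationFamily hKs hH j hab β =
      complexGysin complexOrientationFamily hE hH Θ rfl (complexGysin complexOrientationFamily hKs hE sl hab β) := by
  have h := complexGysin_comp hasPoincareDuality_complexOrientationFamily hKs hE hH sl Θ hab
    (rfl : b + 2 * (2 * (n + 1)) = b + 2 * (2 * (n + 1)))
  rw [hιΘ] at h
  exact LinearMap.congr_fun h β

/-- **`ι_* β = pr_K^* β ∪ ι_* 1`** for the slice `ι = (b, 𝟙_K) : K → A × K` (a section of `pr_K`): the projection
formula `ι_*(ι^* x ∪ y) = x ∪ ι_* y` with `x = pr_K^* β`, `y = 1`, and `ι^* pr_K^* β = β`.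
[cite: KapferMenet2018, Lemma 5.4 (proof) p. 13 ("β ⊗ x")] [cite: FultonYoungTableaux1997, Appendix B §B.1 (6)] -/
theorem complexGysin_slice_eq_cup (hKs : IsSmoothProjective (2 * n) K)
    (hE : IsSmoothProjective (2 * (n + 1)) (A.X ⊗ K)) (b : 𝟙_ (SchemeOver ℂ) ⟶ A.X) {k : ℕ}
    (β : complexBetti K k) :
    complexGysin complexOrientationFamily hKs hE (lift (toUnit K ≫ b) (𝟙 K))
        (show k + 2 * (2 * (n + 1)) = (k + 4) + 2 * (2 * n) by ring) β =
      cupProduct (rfl : k + 4 = k + 4) (complexBetti.map (snd A.X K) k β)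
        (complexGysin complexOrientationFamily hKs hE (lift (toUnit K ≫ b) (𝟙 K))
          (show 0 + 2 * (2 * (n + 1)) = 4 + 2 * (2 * n) by ring) (singularCohomology.one ℂ (ComplexPoints K))) := by
  have key := complexGysin_cup hasPoincareDuality_complexOrientationFamily hKs hE (lift (toUnit K ≫ b) (𝟙 K))
    (p := k) (q := 0) (a := k) (b := k + 4) (q' := 4) (Nat.add_zero k)
    (show k + 2 * (2 * (n + 1)) = (k + 4) + 2 * (2 * n) by ring)
    (show 0 + 2 * (2 * (n + 1)) = 4 + 2 * (2 * n) by ring) rfl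
    (complexBetti.map (snd A.X K) k β) (singularCohomology.one ℂ (ComplexPoints K))
  have hβ : complexBetti.map (lift (toUnit K ≫ b) (𝟙 K)) k (complexBetti.map (snd A.X K) k β) = β := by
    rw [← CategoryTheory.comp_apply, ← complexBetti.map_comp, lift_snd, complexBetti.map_id]
    rfl
  rw [hβ, cupProduct_one] at key
  exact key

variable {G : Type} [Group G] [Fintype G] [MulAction G (ComplexPoints (A.X ⊗ K))]

/-- **Deck transformations fix `ι_* 1`**: `g^*(ι_* 1) = ι_* 1` in `H⁴((A × K)(ℂ); ℂ)` for `ι = (1, 𝟙_K)` and every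
deck transformation `g = (t_b × τ)(ℂ)` of a finite regular cover `Θ(ℂ) : (A × K)(ℂ) → H(ℂ)`.  By Poincaré
duality on `A × K`: for `w = g^* w'`, `∫ g^*(ι_*1) ∪ w = ∫ g^*(ι_*1 ∪ w') = ∫ ι_*1 ∪ w' = ∫_K ι^* w'` (deck
transformations act trivially on top cohomology, `map_deck_eq_self_of_top`; `∫ ι_* 1 ∪ x = ∫_K ι^* x`), while
`∫ ι_*1 ∪ w = ∫_K ι^* g^* w' = ∫_K τ^* ι_b^* w' = ∫_K ι_b^* w' = ∫_K ι^* w'` (`g ∘ ι = ι_b ∘ τ`, `τ` preserves `∫_K`,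
and the slices are homotopic).  This replaces the printed "`Θ^*[K] = n⁴ (1 ⊗ x)`".
[cite: KapferMenet2018, Lemma 5.4 (proof) p. 13] [cite: Beauville1983, §7 p. 769 footnote 2] -/
theorem map_deck_complexGysin_slice_one (hKs : IsSmoothProjective (2 * n) K)
    (hE : IsSmoothProjective (2 * (n + 1)) (A.X ⊗ K)) (hH : IsSmoothProjective (2 * (n + 1)) H)
    (c : FiniteDeckCover G (ComplexPoints (A.X ⊗ K)) (ComplexPoints H)) {g : G}
    {b b' : 𝟙_ (SchemeOver ℂ) ⟶ A.X} {τ τ' : K ⟶ K}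
    (hg : c.deck g = AlgPoints.mapContinuous (L := ℂ) (A.translate b ⊗ₘ τ))
    (hg' : c.deck g⁻¹ = AlgPoints.mapContinuous (L := ℂ) (A.translate b' ⊗ₘ τ')) :
    singularCohomology.map ℂ ℂ (c.deck g) 4
        (complexGysin complexOrientationFamily hKs hE
          (lift (toUnit K ≫ (1 : 𝟙_ (SchemeOver ℂ) ⟶ A.X)) (𝟙 K))
          (show 0 + 2 * (2 * (n + 1)) = 4 + 2 * (2 * n) by ring) (singularCohomology.one ℂ (ComplexPoints K))) =
      complexGysin complexOrientationFamily hKs hE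
        (lift (toUnit K ≫ (1 : 𝟙_ (SchemeOver ℂ) ⟶ A.X)) (𝟙 K))
        (show 0 + 2 * (2 * (n + 1)) = 4 + 2 * (2 * n) by ring) (singularCohomology.one ℂ (ComplexPoints K)) := by
  set sl : K ⟶ A.X ⊗ K := lift (toUnit K ≫ (1 : 𝟙_ (SchemeOver ℂ) ⟶ A.X)) (𝟙 K) with hιdef
  set s1 := complexGysin complexOrientationFamily hKs hE sl
    (show 0 + 2 * (2 * (n + 1)) = 4 + 2 * (2 * n) by ring) (singularCohomology.one ℂ (ComplexPoints K)) with hι1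
  have had : 4 + 2 * (2 * n) = 2 * (2 * (n + 1)) := by ring
  refine eq_of_forall_traceC_cupProduct_eq hE had fun w ↦ ?_
  -- `w = g^* w'` with `w' = (g⁻¹)^* w`
  set w' := singularCohomology.map ℂ ℂ (c.deck g⁻¹) (2 * (2 * n)) w with hw'
  have hgg : (c.deck g⁻¹).comp (c.deck g) = ContinuousMap.id _ :=
    ContinuousMap.ext fun e ↦ inv_smul_smul g e
  have hw : w = singularCohomology.map ℂ ℂ (c.deck g) (2 * (2 * n)) w' := by
    rw [hw', ← ModuleCat.comp_apply, ← singularCohomology.map_comp, hgg, singularCohomology.map_id]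
    rfl
  -- `∫_{A×K} ι_* 1 ∪ x = ∫_K ι^* x`
  have hι : ∀ x : complexBetti (A.X ⊗ K) (2 * (2 * n)),
      traceC hE (cupProduct had s1 x) = traceC hKs (complexBetti.map sl (2 * (2 * n)) x) := by
    intro x
    rw [hι1, traceC_cup_complexGysin hKs hE sl _ (Nat.zero_add _) had, one_cupProduct]
  -- left-hand side
  have hL : traceC hE (cupProduct had (singularCohomology.map ℂ ℂ (c.deck g) 4 s1) w) =
      traceC hKs (complexBetti.map sl (2 * (2 * n)) w') := by
    rw [hw, ← cupProduct_map, map_deck_eq_self_of_top hE hH c g, hι]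
  -- right-hand side: `ι^* g^* w' = τ^* ι_b^* w'`
  have hcomp : (c.deck g).comp (AlgPoints.mapContinuous (L := ℂ) sl) =
      (AlgPoints.mapContinuous (L := ℂ) (lift (toUnit K ≫ b) (𝟙 K))).comp (AlgPoints.mapContinuous (L := ℂ) τ) := by
    rw [hg, ← AlgPoints.mapContinuous_comp, ← AlgPoints.mapContinuous_comp, hιdef,
      sliceOne_comp_translate_tensorHom]
  have hR : traceC hE (cupProduct had s1 w) = traceC hKs (complexBetti.map sl (2 * (2 * n)) w') := by
    rw [hι, hw, complexBetti.map, ← ModuleCat.comp_apply, ← singularCohomology.map_comp, hcomp,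
      singularCohomology.map_comp, ModuleCat.comp_apply]
    change traceC hKs (complexBetti.map τ (2 * (2 * n))
      (complexBetti.map (lift (toUnit K ≫ b) (𝟙 K)) (2 * (2 * n)) w')) = _
    rw [traceC_map_deckSnd hKs c hg hg', complexBetti_map_slice_eq b 1]
  rw [hL, hR]

/-- **`Θ^*(Θ_*(ι_* 1)) = (|G|/μ) • ι_* 1`** — the transfer form of the printed `Θ^*[K] = n⁴ (1 ⊗ x)`:
`Θ^*Θ_* = μ⁻¹ Σ_g g^*` (`map_complexGysin_eq_smul_sum`) and every `g` fixes `ι_* 1`.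
[cite: KapferMenet2018, Lemma 5.4 (proof) p. 13] [cite: HatcherAT2002, §3.G p. 321] -/
theorem map_kummerCover_complexGysin_complexGysin_slice_one (hKs : IsSmoothProjective (2 * n) K)
    (hE : IsSmoothProjective (2 * (n + 1)) (A.X ⊗ K)) (hH : IsSmoothProjective (2 * (n + 1)) H) {Θ : A.X ⊗ K ⟶ H}
    (c : FiniteDeckCover G (ComplexPoints (A.X ⊗ K)) (ComplexPoints H))
    (hc : c.proj = AlgPoints.mapContinuous (L := ℂ) Θ)
    (hdeck : ∀ g : G, ∃ (b : 𝟙_ (SchemeOver ℂ) ⟶ A.X) (τ : K ⟶ K),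
      c.deck g = AlgPoints.mapContinuous (L := ℂ) (A.translate b ⊗ₘ τ))
    {ω : complexBetti (A.X ⊗ K) (2 * (2 * (n + 1)))} (hω : traceC hE ω = 1) :
    complexBetti.map Θ 4 (complexGysin complexOrientationFamily hE hH Θ rfl
        (complexGysin complexOrientationFamily hKs hE
          (lift (toUnit K ≫ (1 : 𝟙_ (SchemeOver ℂ) ⟶ A.X)) (𝟙 K))
          (show 0 + 2 * (2 * (n + 1)) = 4 + 2 * (2 * n) by ring) (singularCohomology.one ℂ (ComplexPoints K)))) =
      ((traceC hH (c.transferMap (2 * (2 * (n + 1))) ω))⁻¹ * Fintype.card G) •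
        complexGysin complexOrientationFamily hKs hE
          (lift (toUnit K ≫ (1 : 𝟙_ (SchemeOver ℂ) ⟶ A.X)) (𝟙 K))
          (show 0 + 2 * (2 * (n + 1)) = 4 + 2 * (2 * n) by ring) (singularCohomology.one ℂ (ComplexPoints K)) := by
  rw [map_complexGysin_eq_smul_sum hE hH Θ c hc hω 4, mul_smul]
  congr 1
  rw [Finset.sum_congr rfl fun g _ ↦ ?_, Finset.sum_const, Finset.card_univ, ← Nat.cast_smul_eq_nsmul ℂ]
  obtain ⟨b, τ, hg⟩ := hdeck g
  obtain ⟨b', τ', hg'⟩ := hdeck g⁻¹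
  exact map_deck_complexGysin_slice_one hKs hE hH c hg hg'

end Gysin

/-! ### §4 Kapfer–Menet Lemma 5.4: `θ_* β ∈ H*(A^[n+1]) ∪ [K]` -/

section KapferMenet

variable {n : ℕ} {A : AbelianVariety ℂ} {K H : SchemeOver ℂ}
  {G : Type} [Group G] [Fintype G] [MulAction G (ComplexPoints (A.X ⊗ K))]

/-- **Kapfer–Menet Lemma 5.4, degreewise, from the cover data**: for a finite regular cover
`Θ(ℂ) : (A × K)(ℂ) → H(ℂ)` (`c.proj = Θ(ℂ)`) whose deck transformations are of the form `(t_b × τ)(ℂ)`, and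
`j = (1, 𝟙_K) ≫ Θ`, every `β ∈ Hᵏ(K(ℂ); ℂ)` has `θ_* β = j_* β = B ∪ [K]` for some `B ∈ Hᵏ(H(ℂ); ℂ)`.  Printed proof,
transfer form: `B₀ := Θ_*(pr_K^* β)`; `[K] ∪ B₀ = Θ_*(Θ^*[K] ∪ pr_K^* β)` (projection formula),
`Θ^*[K] = (|G|/μ) ι_* 1` (`map_kummerCover_complexGysin_complexGysin_slice_one`), `ι_* 1 ∪ pr_K^* β = ι_* β`
(`complexGysin_slice_eq_cup`, graded commutativity), `Θ_* ι_* = θ_*`; `B = (μ/|G|) B₀`.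
[cite: KapferMenet2018, Lemma 5.4 p. 13] [cite: Beauville1983, §7 p. 769 footnote 2] -/
theorem exists_complexGysin_kummerFibre_eq_cup (hKs : IsSmoothProjective (2 * n) K)
    (hE : IsSmoothProjective (2 * (n + 1)) (A.X ⊗ K)) (hH : IsSmoothProjective (2 * (n + 1)) H)
    {Θ : A.X ⊗ K ⟶ H} {j : K ⟶ H}
    (hιΘ : lift (toUnit K ≫ (1 : 𝟙_ (SchemeOver ℂ) ⟶ A.X)) (𝟙 K) ≫ Θ = j)
    (c : FiniteDeckCover G (ComplexPoints (A.X ⊗ K)) (ComplexPoints H))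
    (hc : c.proj = AlgPoints.mapContinuous (L := ℂ) Θ)
    (hdeck : ∀ g : G, ∃ (b : 𝟙_ (SchemeOver ℂ) ⟶ A.X) (τ : K ⟶ K),
      c.deck g = AlgPoints.mapContinuous (L := ℂ) (A.translate b ⊗ₘ τ))
    {k : ℕ} (β : complexBetti K k) :
    ∃ B : complexBetti H k,
      complexGysin complexOrientationFamily hKs hH j
          (show k + 2 * (2 * (n + 1)) = (k + 4) + 2 * (2 * n) by ring) β =
        cupProduct (rfl : k + 4 = k + 4) B (kummerFibreClass hKs hH j) := by
  obtain ⟨ω, hω⟩ := exists_traceC_eq_one hE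
  have hμ0 : traceC hH (c.transferMap (2 * (2 * (n + 1))) ω) ≠ 0 := traceC_transferMap_ne_zero hE hH Θ c hc hω
  have hG : (Fintype.card G : ℂ) ≠ 0 := Nat.cast_ne_zero.mpr Fintype.card_ne_zero
  -- `[K] = Θ_*(ι_* 1)` and `Θ^*[K] = (|G|/μ) • ι_* 1`
  have hK : kummerFibreClass hKs hH j = complexGysin complexOrientationFamily hE hH Θ rfl
      (complexGysin complexOrientationFamily hKs hE (lift (toUnit K ≫ (1 : 𝟙_ (SchemeOver ℂ) ⟶ A.X)) (𝟙 K))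
        (show 0 + 2 * (2 * (n + 1)) = 4 + 2 * (2 * n) by ring) (singularCohomology.one ℂ (ComplexPoints K))) := by
    rw [kummerFibreClass]
    exact complexGysin_kummerFibre_eq_comp hKs hE hH hιΘ _ _
  have hΘK := map_kummerCover_complexGysin_complexGysin_slice_one hKs hE hH c hc hdeck hω
  rw [← hK] at hΘK
  -- `θ_* β = Θ_*(pr_K^* β ∪ ι_* 1)`
  have hθ : complexGysin complexOrientationFamily hKs hH j
        (show k + 2 * (2 * (n + 1)) = (k + 4) + 2 * (2 * n) by ring) β =
      complexGysin complexOrientationFamily hE hH Θ rfl (cupProduct (rfl : k + 4 = k + 4)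
        (complexBetti.map (snd A.X K) k β)
        (complexGysin complexOrientationFamily hKs hE (lift (toUnit K ≫ (1 : 𝟙_ (SchemeOver ℂ) ⟶ A.X)) (𝟙 K))
          (show 0 + 2 * (2 * (n + 1)) = 4 + 2 * (2 * n) by ring) (singularCohomology.one ℂ (ComplexPoints K)))) := by
    rw [complexGysin_kummerFibre_eq_comp hKs hE hH hιΘ, complexGysin_slice_eq_cup hKs hE 1 β]
  -- projection formula for `Θ`: `Θ_*(Θ^*[K] ∪ pr_K^* β) = [K] ∪ Θ_*(pr_K^* β)`
  have hproj := complexGysin_cup hasPoincareDuality_complexOrientationFamily hE hH Θ (p := 4) (q := k)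
    (a := k + 4) (b := k + 4) (q' := k) (by omega) rfl rfl (by omega) (kummerFibreClass hKs hH j)
    (complexBetti.map (snd A.X K) k β)
  rw [hΘK, LinearMap.map_smul₂, map_smul,
    cupProduct_gradedComm_holds ℂ (ComplexPoints (A.X ⊗ K)) (show 4 + k = k + 4 by omega) rfl,
    cupProduct_gradedComm_holds ℂ (ComplexPoints H) (show 4 + k = k + 4 by omega) rfl,
    show 4 * k = 2 * (2 * k) by ring, pow_mul, neg_one_sq, one_pow, one_smul, one_smul, ← hθ] at hproj
  -- `hproj : (μ⁻¹ |G|) • θ_* β = Θ_*(pr_K^* β) ∪ [K]`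
  refine ⟨((traceC hH (c.transferMap (2 * (2 * (n + 1))) ω))⁻¹ * Fintype.card G)⁻¹ •
    complexGysin complexOrientationFamily hE hH Θ rfl (complexBetti.map (snd A.X K) k β), ?_⟩
  rw [LinearMap.map_smul₂, ← hproj, smul_smul, inv_mul_cancel₀ (mul_ne_zero (inv_ne_zero hμ0) hG), one_smul]

/-- **Kapfer–Menet Lemma 5.4 (the named fact `KapferMenet2018_lemma_5_4`) follows from Beauville's Galois cover
(`Beauville1983_kummerCover_galois`).**  For the data of the fact (a Hilbert scheme `(H, Ξ)` of `m + 1` points of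
the abelian surface `A`, a Kummer fibre `j : K ⟶ H`): take the translation action `act` (`translationAction`,
PROVED to be one), the cover `Θ = kummerCover act j` with `(1, 𝟙_K) ≫ Θ = j`
(`IsTranslationAction.lift_one_id_comp_kummerCover`), and the finite regular covering structure on `Θ(ℂ)` given
by the Galois-cover fact; apply `exists_complexGysin_kummerFibre_eq_cup` degreewise and assemble on `⨁ₖ Hᵏ`
(rescaling `B` by the printed constant `(m+1)⁴`). [cite: KapferMenet2018, Lemma 5.4 p. 13]
[cite: Beauville1983, §7 p. 769 footnote 2] -/
theorem kapferMenet2018_lemma_5_4_of_galois (hgal : Beauville1983_kummerCover_galois) :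
    KapferMenet2018_lemma_5_4 := by
  intro m A K H hA Ξ 𝒜 x₀ j hHilb hH hsq hKs β
  classical
  -- the translation action and Beauville's cover
  have hact : IsTranslationAction Ξ (translationAction hHilb) := isTranslationAction_translationAction hHilb
  obtain ⟨G, _, _, _, c, hc, -, hdeck, -⟩ := hgal hA Ξ 𝒜 x₀ j (translationAction hHilb) hHilb hH hsq hKs hact
  have hdeck' : ∀ g : G, ∃ (b : 𝟙_ (SchemeOver ℂ) ⟶ A.X) (τ : K ⟶ K),
      c.deck g = AlgPoints.mapContinuous (L := ℂ) (A.translate b ⊗ₘ τ) := by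
    intro g
    obtain ⟨b, τ, -, -, hg⟩ := hdeck g
    exact ⟨b⁻¹, τ, hg⟩
  have hE := isSmoothProjective_abelianSurface_tensor (K := K) hA hKs
  have hιΘ := hact.lift_one_id_comp_kummerCover hHilb j
  have hc0 : (((m + 1 : ℕ) : ℂ) ^ 4) ≠ 0 := pow_ne_zero _ (Nat.cast_ne_zero.mpr (Nat.succ_ne_zero m))
  -- assemble over the direct sum
  induction β using DirectSum.induction_on with
  | zero => exact ⟨0, by rw [map_zero, map_zero, LinearMap.zero_apply, smul_zero]⟩
  | of k β =>
    obtain ⟨B, hB⟩ := exists_complexGysin_kummerFibre_eq_cup hKs hE hH hιΘ c hc hdeck' β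
    refine ⟨ofDegree ℂ (ComplexPoints H) k ((((m + 1 : ℕ) : ℂ) ^ 4) • B), ?_⟩
    rw [← DirectSum.lof_eq_of ℂ, kummerFibreClassTotal]
    change totalGysin hKs hH j 4 _ (ofDegree ℂ (ComplexPoints K) k β) = _
    rw [totalGysin_ofDegree, totalCup_lof, LinearMap.map_smul₂, map_smul, smul_smul, inv_mul_cancel₀ hc0,
      one_smul, ← hB]
  | add β β' hβ hβ' =>
    obtain ⟨B, hB⟩ := hβ
    obtain ⟨B', hB'⟩ := hβ'
    exact ⟨B + B', by rw [map_add, hB, hB', map_add, LinearMap.add_apply, smul_add]⟩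

end KapferMenet

/-! ### §5 Kapfer–Menet Proposition 5.5: `ker θ^* = Ann([K])` -/

section KernelAnnihilator

variable {n : ℕ} {A : AbelianVariety ℂ} {K H : SchemeOver ℂ}

/-- **`θ^* x = 0 ⇒ [K] ∪ x = 0`** (degreewise): `x ∪ [K] = x ∪ θ_* 1 = θ_*(θ^* x ∪ 1) = 0` by the projection
formula, and `[K]` has even degree.  ("Assume `α ∈ ker(θ^*)`. Then we have `[K]·α = θ_*θ^*(α) = 0`.")
[cite: KapferMenet2018, Prop. 5.5 (proof) p. 13] [cite: FultonYoungTableaux1997, Appendix B §B.1 (6)] -/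
theorem cupProduct_kummerFibreClass_eq_zero_of_map_eq_zero (hKs : IsSmoothProjective (2 * n) K)
    (hH : IsSmoothProjective (2 * (n + 1)) H) (j : K ⟶ H) {k : ℕ} {x : complexBetti H k}
    (hx : complexBetti.map j k x = 0) :
    cupProduct (rfl : 4 + k = 4 + k) (kummerFibreClass hKs hH j) x = 0 := by
  have key := complexGysin_cup hasPoincareDuality_complexOrientationFamily hKs hH j (p := k) (q := 0) (a := k)
    (b := 4 + k) (q' := 4) (Nat.add_zero k) (show k + 2 * (2 * (n + 1)) = (4 + k) + 2 * (2 * n) by ring)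
    (show 0 + 2 * (2 * (n + 1)) = 4 + 2 * (2 * n) by ring) (Nat.add_comm k 4) x
    (singularCohomology.one ℂ (ComplexPoints K))
  rw [hx, LinearMap.map_zero₂, map_zero] at key
  rw [kummerFibreClass, cupProduct_gradedComm_holds ℂ (ComplexPoints H) rfl (Nat.add_comm k 4), ← key, smul_zero]

/-- **`[K] ∪ x = 0 ⇒ θ^* x = 0`** (degreewise), granted Lemma 5.4 in the form "`θ_* w = B ∪ [K]`": by Poincaré
duality on `K`, `∫_K θ^* x ∪ w = ± ∫_H θ_* w ∪ x = ± ∫_H B ∪ ([K] ∪ x) = 0` for every `w`.  ("Conversely … let `β`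
be the Poincaré dual of `θ^*(α)` … by Lemma 5.4 there exists `B` such that `B·[K]·α ≠ 0`.")
[cite: KapferMenet2018, Prop. 5.5 (proof) p. 13] [cite: HatcherAT2002, §3.3 Prop. 3.38] -/
theorem map_eq_zero_of_cupProduct_kummerFibreClass_eq_zero (hKs : IsSmoothProjective (2 * n) K)
    (hH : IsSmoothProjective (2 * (n + 1)) H) (j : K ⟶ H)
    (h54 : ∀ (d : ℕ) (w : complexBetti K d), ∃ B : complexBetti H d,
      complexGysin complexOrientationFamily hKs hH j
          (show d + 2 * (2 * (n + 1)) = (d + 4) + 2 * (2 * n) by ring) w =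
        cupProduct (rfl : d + 4 = d + 4) B (kummerFibreClass hKs hH j))
    {k : ℕ} {x : complexBetti H k} (hx : cupProduct (rfl : 4 + k = 4 + k) (kummerFibreClass hKs hH j) x = 0) :
    complexBetti.map j k x = 0 := by
  refine eq_of_forall_traceC_cupProduct_eq' hKs fun d hkd w ↦ ?_
  obtain ⟨B, hB⟩ := h54 d w
  have hdk : d + k = 2 * (2 * n) := by omega
  rw [LinearMap.map_zero₂, map_zero,
    cupProduct_gradedComm_holds ℂ (ComplexPoints K) hkd hdk (complexBetti.map j k x) w, map_smul,
    ← traceC_cup_complexGysin hKs hH j (show d + 2 * (2 * (n + 1)) = (d + 4) + 2 * (2 * n) by ring) hdk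
      (show (d + 4) + k = 2 * (2 * (n + 1)) by omega) w x,
    hB, cupProduct_assoc rfl rfl (show (d + 4) + k = 2 * (2 * (n + 1)) by omega)
      (show d + (4 + k) = 2 * (2 * (n + 1)) by omega) B (kummerFibreClass hKs hH j) x,
    hx, map_zero, map_zero, smul_zero]

/-- **Kapfer–Menet Prop. 5.5, the inclusion `ker θ^* ⊆ Ann([K])` — unconditionally** (on the total cohomology
`H*(A^[n+1](ℂ); ℂ)`, for any `j : K ⟶ H` of smooth projective varieties of dimensions `2n`, `2(n+1)`).
[cite: KapferMenet2018, Prop. 5.5 p. 13] -/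
theorem ker_totalPullback_le_cupAnnihilator (hKs : IsSmoothProjective (2 * n) K)
    (hH : IsSmoothProjective (2 * (n + 1)) H) (j : K ⟶ H) :
    LinearMap.ker (totalPullback ℂ (AlgPoints.mapContinuous (L := ℂ) j)) ≤
      cupAnnihilator ℂ (ComplexPoints H) (kummerFibreClassTotal hKs hH j) := by
  intro v hv
  rw [LinearMap.mem_ker, totalPullback_eq_zero_iff] at hv
  rw [mem_cupAnnihilator_iff, kummerFibreClassTotal, totalCup_ofDegree_eq_zero_iff]
  exact fun k ↦ cupProduct_kummerFibreClass_eq_zero_of_map_eq_zero hKs hH j (hv k)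

/-- **Kapfer–Menet Prop. 5.5 (the named fact `KapferMenet2018_ker_pullback_eq_annihilator`) follows from
Lemma 5.4 (the named fact `KapferMenet2018_lemma_5_4`)**: `⊆` is `ker_totalPullback_le_cupAnnihilator`; for `⊇`
read Lemma 5.4 degreewise (component `d + 4` of the total identity) and apply Poincaré duality on `K`
(`map_eq_zero_of_cupProduct_kummerFibreClass_eq_zero`). [cite: KapferMenet2018, Prop. 5.5 p. 13 and Lemma 5.4] -/
theorem kapferMenet2018_ker_pullback_eq_annihilator_of_lemma_5_4 (h54 : KapferMenet2018_lemma_5_4) :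
    KapferMenet2018_ker_pullback_eq_annihilator := by
  intro m A K H hA Ξ 𝒜 x₀ j hHilb hH hsq hKs
  have hc0 : (((m + 1 : ℕ) : ℂ) ^ 4) ≠ 0 := pow_ne_zero _ (Nat.cast_ne_zero.mpr (Nat.succ_ne_zero m))
  -- Lemma 5.4 degreewise: the component of degree `d + 4` of the total identity
  have h54deg : ∀ (d : ℕ) (w : complexBetti K d), ∃ B : complexBetti H d,
      complexGysin complexOrientationFamily hKs hH j
          (show d + 2 * (2 * (m + 1)) = (d + 4) + 2 * (2 * m) by ring) w =
        cupProduct (rfl : d + 4 = d + 4) B (kummerFibreClass hKs hH j) := by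
    intro d w
    obtain ⟨Bt, hBt⟩ := h54 hA Ξ 𝒜 x₀ j hHilb hH hsq hKs (ofDegree ℂ (ComplexPoints K) d w)
    have h := congrArg (fun v : totalCohomology ℂ (ComplexPoints H) ↦ v (d + 4)) hBt
    simp only at h
    rw [totalGysin_ofDegree, DirectSum.lof_eq_of, DirectSum.of_eq_same, DirectSum.smul_apply, kummerFibreClassTotal,
      totalCup_apply_ofDegree_add] at h
    exact ⟨(((m + 1 : ℕ) : ℂ) ^ 4)⁻¹ • Bt d, by rw [LinearMap.map_smul₂, ← h]⟩
  refine le_antisymm (ker_totalPullback_le_cupAnnihilator hKs hH j) fun v hv ↦ ?_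
  rw [mem_cupAnnihilator_iff, kummerFibreClassTotal, totalCup_ofDegree_eq_zero_iff] at hv
  rw [LinearMap.mem_ker, totalPullback_eq_zero_iff]
  exact fun k ↦ map_eq_zero_of_cupProduct_kummerFibreClass_eq_zero hKs hH j h54deg (hv k)

/-- **Kapfer–Menet Prop. 5.5 follows from Beauville's Galois cover** (`Beauville1983_kummerCover_galois`), through
Lemma 5.4 (`kapferMenet2018_lemma_5_4_of_galois`). [cite: KapferMenet2018, Prop. 5.5 p. 13]
[cite: Beauville1983, §7 p. 769 footnote 2] -/
theorem kapferMenet2018_ker_pullback_eq_annihilator_of_galois (hgal : Beauville1983_kummerCover_galois) :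
    KapferMenet2018_ker_pullback_eq_annihilator :=
  kapferMenet2018_ker_pullback_eq_annihilator_of_lemma_5_4 (kapferMenet2018_lemma_5_4_of_galois hgal)

/-- **Kapfer–Menet Prop. 5.7, the inclusion `⟨H¹(A^[n+1])⟩ ⊆ Ann([K])` — from `b₁(K) = 0`**: a generator `x ∪ g`,
`g ∈ H¹`, restricts to `θ^* x ∪ θ^* g = 0` on `K` (`H¹(K(ℂ); ℂ) = 0` for a generalized Kummer variety, Beauville §7
Thm. 4 — here the hypothesis `h1`), so it lies in `ker θ^* ⊆ Ann([K])` (`ker_totalPullback_le_cupAnnihilator`).  The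
reverse inclusion is the content of Prop. 5.7 and is NOT proved here. [cite: KapferMenet2018, Prop. 5.7 pp. 13–14]
[cite: Beauville1983, §7 Théorème 4] -/
theorem cupIdeal_degreeOne_le_cupAnnihilator_of_h1 (hKs : IsSmoothProjective (2 * n) K)
    (hH : IsSmoothProjective (2 * (n + 1)) H) (j : K ⟶ H) (h1 : ∀ x : complexBetti K 1, x = 0) :
    cupIdeal ℂ (ComplexPoints H) (degreeClasses ℂ (ComplexPoints H) {1}) ≤
      cupAnnihilator ℂ (ComplexPoints H) (kummerFibreClassTotal hKs hH j) := by
  refine Submodule.span_le.mpr ?_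
  rintro z ⟨x, g, hg, rfl⟩
  refine ker_totalPullback_le_cupAnnihilator hKs hH j ?_
  rw [degreeClasses, Set.mem_iUnion₂] at hg
  obtain ⟨k, hk, g₁, rfl⟩ := hg
  rw [Set.mem_singleton_iff] at hk
  subst hk
  rw [LinearMap.mem_ker, totalPullback_totalCup, totalPullback_lof, h1 (singularCohomology.map ℂ ℂ _ 1 g₁), map_zero,
    map_zero]

end KernelAnnihilator

end Literature.AlgebraicGeometry.Hyperkaehler

end
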